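import Summits.AtomisticToContinuum.Crystallization.Theses.PalmUnimodularRigidity
import Summits.AtomisticToContinuum.Crystallization.Theorems.MinimiserShells.Negative.LoadBearing
import Summits.AtomisticToContinuum.Crystallization.Theorems.MinimiserShells.Negative.Rootedness
import Summits.AtomisticToContinuum.Crystallization.Theorems.LayeredLawsSelectHcp.Negative.Threshold
import Summits.AtomisticToContinuum.Crystallization.Theorems.ChargedEnergyGap.Negative.Unconditional
import Literature.Probability.Process.PointStationaryLaw
import Literature.MathematicalPhysics.StatisticalMechanics.RootEnergy
import Literature.MathematicalPhysics.StatisticalMechanics.MuGSC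

/-!
# Sütő `μ`GSCs of Lennard-Jones at the bulk chemical potential `e*`: one-point tests, cohesion,
# local density and a uniform hard core

Groundwork (`--supports stmt-AtomisticToContinuum-9225`, registered marker `stub_dlrBadZeroDensity_part01`) for
the deterministic open stub S3′ `stub_dlrBadZeroDensity` (and the gen-2 pair S3/S4) of line `equilibrium-in-law-surgery`,
crux `MinimiserShells` (route `PalmUnimodularRigidity`): elementary consequences of `IsMuGSC` (no finite modification
"remove `n`, insert `k`" lowers `U − μ·#`), of the shell sum, and of `N·e* ≤ E_LJ(y)` (`card_mul_eStar_le`) and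
`e* ≤ −1/2` (`eStar_le_neg_half`).
* Two-scale shell sums `∑_{z ∈ t} |p − z|⁻⁶ ≤ 250 η⁻³ ρ⁻³` (`sum_inv_pow_six_le_of_sep`, `summable_inv_pow_six`).
* One-point tests (any radial `V`, `μ`, dimension): EVAPORATION `∑_{y ∈ S∖{x}} V ≤ μ` (`tsum_sdiff_singleton_le`),
  CONDENSATION `μ ≤ ∑_{y ∈ S} V(|r − y|)` at holes (`le_tsum_of_not_mem`), COHESION: the binding of a finite part is `≤`
  the field felt by any translate of it off `S` (`fieldEnergy_le_fieldEnergy_translate`, `…_sdiff`).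
* Lennard-Jones at `μ = e*`: `e* < 0`; local density `6·(−e*) ≤ ∑_{y ≠ x} |x − y|⁻⁶ (≥ 3)`
  (`six_mul_neg_eStar_le_tsum`, `three_le_tsum_inv_pow_six`); a UNIFORM HARD CORE `1/3` (`le_dist`), hence universal
  packing `#(S ∩ B̄_R(x)) ≤ (6R + 1)³` (`ncard_le`); no isolated atom (`exists_dist_lt`, within `14`).
* Sanity: the vacuum is an `e*`-μGSC (`isMuGSC_empty`); no singleton is (`not_isMuGSC_singleton`).
Not here: the particle-level positive surface tension that S4 needs (open); anything about shells.
-/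

noncomputable section

open MeasureTheory
open scoped ENNReal BigOperators

namespace Summit.AtomisticToContinuum.Crystallization.Theorems.PalmUnimodularRigidityMinimiserShells.VolumeGrowth.Basics

open Literature.MathematicalPhysics.StatisticalMechanics (lennardJones IsMuGSC UniformlyDiscrete interactionEnergy
  fieldEnergy fieldEnergy_eq interactionEnergy_of_subsingleton interactionEnergy_add_const
  card_le_of_separated_of_dist_le isMuGSC_empty_iff)
open Summit.AtomisticToContinuum.Crystallization.Theorems.MinimiserShells.Negative.LoadBearing (eStar)
open Summit.AtomisticToContinuum.Crystallization.Theorems.ChargedEnergyGapNegative (card_mul_eStar_le)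

open Summit.AtomisticToContinuum.Crystallization.Theorems.MinimiserShells.Negative.Rootedness (E3)

/-! ## Shell sums with two scales -/

/-- **Shell sum, separation `η`, distance `ρ`.** If the points of a finite set `t ⊆ ℝ³` are
pairwise `≥ η` apart and all at distance `≥ ρ ≥ η` from `p`, then `∑_{z ∈ t} |p − z|⁻⁶ ≤ 250 η⁻³ ρ⁻³`:
the shell `⌊|p − z|/ρ⌋ = b ≥ 1` holds at most `((2b+3)ρ/η)³ ≤ 125 b³ (ρ/η)³` points (packing), each
contributing `≤ (bρ)⁻⁶`, and `∑_{b ≥ 1} b⁻² ≤ 2`.  (`ρ = η`: `sum_inv_pow_six_le_of_le_dist`.) -/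
theorem sum_inv_pow_six_le_of_sep (t : Finset E3) (p : E3) {η ρ : ℝ} (hη : 0 < η) (hηρ : η ≤ ρ)
    (hp : ∀ z ∈ t, ρ ≤ dist p z) (ht : ∀ z ∈ t, ∀ w ∈ t, z ≠ w → η ≤ dist z w) :
    ∑ z ∈ t, (dist p z)⁻¹ ^ 6 ≤ 250 * (η⁻¹ ^ 3 * ρ⁻¹ ^ 3) := by
  classical
  have hρ : 0 < ρ := hη.trans_le hηρ
  set m : E3 → ℕ := fun z => ⌊dist p z / ρ⌋₊ with hm
  set u := t.image m with hu_def
  have hmem : ∀ z ∈ t, m z ∈ u := fun z hz => Finset.mem_image_of_mem m hz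
  have hm1 : ∀ z ∈ t, 1 ≤ m z := fun z hz =>
    (Nat.one_le_floor_iff _).2 ((one_le_div hρ).2 (hp z hz))
  have hmle : ∀ z ∈ t, ρ * m z ≤ dist p z := fun z hz => by
    have := Nat.floor_le (div_nonneg dist_nonneg hρ.le : 0 ≤ dist p z / ρ)
    rwa [le_div_iff₀ hρ, mul_comm] at this
  have hmlt : ∀ z ∈ t, dist p z < (m z + 1) * ρ := fun z hz => by
    have := Nat.lt_floor_add_one (dist p z / ρ)
    rwa [div_lt_iff₀ hρ] at this
  -- termwise: `|p - z|⁻⁶ ≤ (ρ m_z)⁻⁶`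
  have step1 : ∑ z ∈ t, (dist p z)⁻¹ ^ 6 ≤ ∑ z ∈ t, ρ⁻¹ ^ 6 * ((m z : ℝ))⁻¹ ^ 6 := by
    refine Finset.sum_le_sum fun z hz => ?_
    rw [← mul_pow, ← mul_inv]
    have h0 : 0 < ρ * m z := mul_pos hρ (by exact_mod_cast hm1 z hz)
    exact pow_le_pow_left₀ (inv_nonneg.2 dist_nonneg) (inv_anti₀ h0 (hmle z hz)) _
  -- regroup by shells
  have step2 : ∑ z ∈ t, ρ⁻¹ ^ 6 * ((m z : ℝ))⁻¹ ^ 6 =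
      ∑ b ∈ u, ((t.filter fun z => m z = b).card : ℝ) * (ρ⁻¹ ^ 6 * ((b : ℝ))⁻¹ ^ 6) := by
    have := Finset.sum_fiberwise_of_maps_to' hmem (fun b : ℕ => ρ⁻¹ ^ 6 * ((b : ℝ))⁻¹ ^ 6)
    simp only [Finset.sum_const, nsmul_eq_mul] at this
    exact this.symm
  -- each shell holds at most `((2b+3) ρ/η)³` points
  have step3 : ∀ b ∈ u, ((t.filter fun z => m z = b).card : ℝ) ≤ ((2 * (b : ℝ) + 3) * (ρ / η)) ^ 3 := by
    intro b _
    set F := t.filter fun z => m z = b with hF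
    have hR : (0 : ℝ) ≤ ((b : ℝ) + 1) * ρ := by positivity
    have hcard := card_le_of_separated_of_dist_le F p hη hR ?_ ?_
    · rw [finrank_euclideanSpace_fin] at hcard
      refine hcard.trans (pow_le_pow_left₀ (by positivity) ?_ 3)
      have h1 : (1 : ℝ) ≤ ρ / η := (one_le_div hη).2 hηρ
      calc 2 * (((b : ℝ) + 1) * ρ) / η + 1 ≤ 2 * (((b : ℝ) + 1) * ρ) / η + ρ / η := by linarith
        _ = (2 * (b : ℝ) + 3) * (ρ / η) := by ring
    · intro c hc
      obtain ⟨hct, hcb⟩ := Finset.mem_filter.1 hc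
      rw [dist_comm]
      have := hmlt c hct
      rw [hcb] at this
      exact this.le
    · intro c hc c' hc' hne
      exact ht c (Finset.mem_filter.1 hc).1 c' (Finset.mem_filter.1 hc').1 hne
  -- numerics per shell: `((2b+3) ρ/η)³ ρ⁻⁶ b⁻⁶ ≤ 125 η⁻³ ρ⁻³ b⁻²` for `b ≥ 1`
  have step4 : ∀ b ∈ u, ((2 * (b : ℝ) + 3) * (ρ / η)) ^ 3 * (ρ⁻¹ ^ 6 * ((b : ℝ))⁻¹ ^ 6) ≤
      125 * (η⁻¹ ^ 3 * ρ⁻¹ ^ 3) * ((b : ℝ) ^ 2)⁻¹ := by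
    intro b hb
    obtain ⟨z, hz, rfl⟩ := Finset.mem_image.1 hb
    have hb1 : (1 : ℝ) ≤ (m z : ℝ) := by exact_mod_cast hm1 z hz
    set β : ℝ := (m z : ℝ)
    have hβ : 0 < β := by linarith
    have key : (2 * β + 3) ^ 3 * (β⁻¹) ^ 6 ≤ 125 * (β ^ 2)⁻¹ := by
      rw [inv_pow, ← div_eq_mul_inv, ← div_eq_mul_inv,
        div_le_div_iff₀ (by positivity) (by positivity)]
      have h5 : (2 * β + 3) ^ 3 ≤ (5 * β) ^ 3 :=
        pow_le_pow_left₀ (by positivity) (by linarith) 3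
      have h6 : β ^ 5 ≤ β ^ 6 := pow_le_pow_right₀ hb1 (by norm_num)
      nlinarith [mul_le_mul_of_nonneg_right h5 (sq_nonneg β)]
    have hρη : (ρ / η) ^ 3 * ρ⁻¹ ^ 6 = η⁻¹ ^ 3 * ρ⁻¹ ^ 3 := by
      have hρ0 : ρ ≠ 0 := hρ.ne'
      have hη0 : η ≠ 0 := hη.ne'
      field_simp
    calc ((2 * β + 3) * (ρ / η)) ^ 3 * (ρ⁻¹ ^ 6 * (β⁻¹) ^ 6)
        = ((ρ / η) ^ 3 * ρ⁻¹ ^ 6) * ((2 * β + 3) ^ 3 * (β⁻¹) ^ 6) := by ring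
      _ ≤ (η⁻¹ ^ 3 * ρ⁻¹ ^ 3) * (125 * (β ^ 2)⁻¹) := by
          rw [hρη]; exact mul_le_mul_of_nonneg_left key (by positivity)
      _ = 125 * (η⁻¹ ^ 3 * ρ⁻¹ ^ 3) * (β ^ 2)⁻¹ := by ring
  -- `∑_{b ∈ u} b⁻² ≤ 2`
  have step5 : ∑ b ∈ u, ((b : ℝ) ^ 2)⁻¹ ≤ 2 := by
    have hsub : u ⊆ Finset.Ioo 0 (u.sup id + 1) := fun b hb => by
      rw [Finset.mem_Ioo]
      obtain ⟨z, hz, rfl⟩ := Finset.mem_image.1 hb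
      exact ⟨hm1 z hz, Nat.lt_succ_of_le (Finset.le_sup (f := id) hb)⟩
    have h2 := sum_Ioo_inv_sq_le (α := ℝ) 0 (u.sup id + 1)
    calc ∑ b ∈ u, ((b : ℝ) ^ 2)⁻¹ ≤ ∑ b ∈ Finset.Ioo 0 (u.sup id + 1), ((b : ℝ) ^ 2)⁻¹ :=
          Finset.sum_le_sum_of_subset_of_nonneg hsub fun b _ _ => by positivity
      _ ≤ 2 := by simpa using h2
  calc ∑ z ∈ t, (dist p z)⁻¹ ^ 6
      ≤ ∑ b ∈ u, ((t.filter fun z => m z = b).card : ℝ) * (ρ⁻¹ ^ 6 * ((b : ℝ))⁻¹ ^ 6) :=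
        step1.trans_eq step2
    _ ≤ ∑ b ∈ u, ((2 * (b : ℝ) + 3) * (ρ / η)) ^ 3 * (ρ⁻¹ ^ 6 * ((b : ℝ))⁻¹ ^ 6) :=
        Finset.sum_le_sum fun b hb => mul_le_mul_of_nonneg_right (step3 b hb) (by positivity)
    _ ≤ ∑ b ∈ u, 125 * (η⁻¹ ^ 3 * ρ⁻¹ ^ 3) * ((b : ℝ) ^ 2)⁻¹ := Finset.sum_le_sum step4
    _ = 125 * (η⁻¹ ^ 3 * ρ⁻¹ ^ 3) * ∑ b ∈ u, ((b : ℝ) ^ 2)⁻¹ := by rw [Finset.mul_sum]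
    _ ≤ 125 * (η⁻¹ ^ 3 * ρ⁻¹ ^ 3) * 2 := mul_le_mul_of_nonneg_left step5 (by positivity)
    _ = 250 * (η⁻¹ ^ 3 * ρ⁻¹ ^ 3) := by ring

/-- **Shell sums over a set.** If `X ⊆ ℝ³` is `η`-separated and all its points are at distance
`≥ ρ ≥ η > 0` from `p`, then `z ↦ |p − z|⁻⁶` is summable over `X` with sum `≤ 250 η⁻³ ρ⁻³`
(uniformly bounded partial sums of a non-negative family). -/
theorem summable_inv_pow_six {X : Set E3} {p : E3} {η ρ : ℝ} (hη : 0 < η) (hηρ : η ≤ ρ)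
    (hp : ∀ z ∈ X, ρ ≤ dist p z) (hX : ∀ z ∈ X, ∀ w ∈ X, z ≠ w → η ≤ dist z w) :
    Summable (fun z : X => (dist p z)⁻¹ ^ 6) ∧
      ∑' z : X, (dist p z)⁻¹ ^ 6 ≤ 250 * (η⁻¹ ^ 3 * ρ⁻¹ ^ 3) := by
  classical
  have hnn : 0 ≤ fun z : X => (dist p (z : E3))⁻¹ ^ 6 := fun z => by positivity
  have hbound : ∀ u : Finset X, ∑ z ∈ u, (dist p (z : E3))⁻¹ ^ 6 ≤ 250 * (η⁻¹ ^ 3 * ρ⁻¹ ^ 3) := by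
    intro u
    have h := sum_inv_pow_six_le_of_sep (u.image Subtype.val) p hη hηρ
      (fun z hz => by
        obtain ⟨y, -, rfl⟩ := Finset.mem_image.1 hz
        exact hp y y.2)
      (fun z hz w hw hzw => by
        obtain ⟨y, -, rfl⟩ := Finset.mem_image.1 hz
        obtain ⟨y', -, rfl⟩ := Finset.mem_image.1 hw
        exact hX y y.2 y' y'.2 hzw)
    rwa [Finset.sum_image fun a _ b _ h => Subtype.val_injective h] at h
  exact ⟨summable_of_sum_le hnn hbound, Real.tsum_le_of_sum_le hnn hbound⟩

/-! ## One-point tests and cohesion of a `μ`GSC (any potential, any `μ`, any dimension) -/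

section General

variable {d : ℕ} {V : ℝ → ℝ} {μ : ℝ} {S : Set (EuclideanSpace ℝ (Fin d))}

/-- **Evaporation.** In a `μ`GSC every atom `x` is bound by at least `−μ`:
`∑_{y ∈ S ∖ {x}} V(|x − y|) ≤ μ` (the removal test `IsMuGSC.removal` with `n = 1`; a single
point has no self-interaction). -/
theorem tsum_sdiff_singleton_le (h : IsMuGSC V μ S) {x : EuclideanSpace ℝ (Fin d)} (hx : x ∈ S) :
    ∑' y : ↥(S \ {x}), V (dist x y) ≤ μ := by
  have hinj : Function.Injective (fun _ : Fin 1 => x) := Function.injective_of_subsingleton _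
  have hrange : Set.range (fun _ : Fin 1 => x) = {x} := Set.range_const
  have hsub : Set.range (fun _ : Fin 1 => x) ⊆ S := by
    rw [hrange]; exact Set.singleton_subset_iff.2 hx
  have key := h.removal hinj hsub
  rw [hrange, interactionEnergy_of_subsingleton, fieldEnergy_eq, Fin.sum_univ_one, Nat.cast_one,
    mul_one, zero_add] at key
  exact key

/-- **Condensation.** In a `μ`GSC no hole gains more than `−μ`: for `r ∉ S`,
`μ ≤ ∑_{y ∈ S} V(|r − y|)` (the insertion test `IsMuGSC.insertion` with `k = 1`). -/
theorem le_tsum_of_not_mem (h : IsMuGSC V μ S) {r : EuclideanSpace ℝ (Fin d)} (hr : r ∉ S) :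
    μ ≤ ∑' y : ↥S, V (dist r y) := by
  have hinj : Function.Injective (fun _ : Fin 1 => r) := Function.injective_of_subsingleton _
  have hrange : Set.range (fun _ : Fin 1 => r) = {r} := Set.range_const
  have hdisj : Disjoint (Set.range (fun _ : Fin 1 => r)) S := by
    rw [hrange]; exact Set.disjoint_singleton_left.2 hr
  have key := h.insertion hinj hdisj
  rw [interactionEnergy_of_subsingleton, fieldEnergy_eq, Fin.sum_univ_one, Nat.cast_one, mul_one,
    zero_add] at key
  exact key

/-- **Cohesion (removal against insertion of a translate).** In a `μ`GSC, for every finite part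
`X_f` (`n` distinct atoms `xf`) and every vector `v` such that the translate `X_f + v` misses `S`:
`I(X_f, S ∖ X_f) ≤ I(X_f + v, S)` — the (negative) binding of `X_f` to the rest is at most the
field a ghost copy of `X_f` feels anywhere off `S`.  Proof: removal gives
`U(X_f) + I(X_f, S ∖ X_f) ≤ μ n`, insertion of the translate gives `μ n ≤ U(X_f + v) + I(X_f + v, S)`,
and `U(X_f + v) = U(X_f)`.  For Lennard-Jones this forbids thin slabs at any `μ`: a ghost slab
piece stacked at height `1` above an `ℓ × ℓ × w` piece feels `≲ −c ℓ²`, while the piece's binding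
is `≳ −C ℓ w`. -/
theorem fieldEnergy_le_fieldEnergy_translate (h : IsMuGSC V μ S) {n : ℕ}
    {xf : Fin n → EuclideanSpace ℝ (Fin d)} (hxf : Function.Injective xf) (hX : Set.range xf ⊆ S)
    (v : EuclideanSpace ℝ (Fin d)) (hdisj : Disjoint (Set.range fun i => xf i + v) S) :
    fieldEnergy V xf (S \ Set.range xf) ≤ fieldEnergy V (fun i => xf i + v) S := by
  have hinj : Function.Injective fun i => xf i + v := fun i j hij => hxf (add_right_cancel hij)
  have h1 := h.removal hxf hX
  have h2 := h.insertion hinj hdisj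
  rw [interactionEnergy_add_const] at h2
  linarith

/-- **Cohesion, particle-conserving form (rigid displacement never gains).** In a `μ`GSC, for
every finite part `X_f` and every `v` with `X_f + v` off `S ∖ X_f`:
`I(X_f, S ∖ X_f) ≤ I(X_f + v, S ∖ X_f)` (`IsMuGSC.exchange` with `R = X_f + v`, and
`U(X_f + v) = U(X_f)`). -/
theorem fieldEnergy_le_fieldEnergy_translate_sdiff (h : IsMuGSC V μ S) {n : ℕ}
    {xf : Fin n → EuclideanSpace ℝ (Fin d)} (hxf : Function.Injective xf) (hX : Set.range xf ⊆ S)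
    (v : EuclideanSpace ℝ (Fin d)) (hdisj : Disjoint (Set.range fun i => xf i + v) (S \ Set.range xf)) :
    fieldEnergy V xf (S \ Set.range xf) ≤ fieldEnergy V (fun i => xf i + v) (S \ Set.range xf) := by
  have hinj : Function.Injective fun i => xf i + v := fun i j hij => hxf (add_right_cancel hij)
  have key := h.exchange hxf hX hinj hdisj
  rw [interactionEnergy_add_const] at key
  linarith

end General

/-! ## Lennard-Jones at `μ = e*` -/

section LennardJones

variable {S : Set E3}

/-- `e* < 0`. -/
theorem eStar_neg : eStar < 0 := by
  have hE : eStar ≤ -1 / 2 := LayeredLawsSelectHcp.Negative.Threshold.eStar_le_neg_half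
  linarith

/-- **The vacuum is an `e*`-`μ`GSC of Lennard-Jones** (sanity; `μ k ≤ U(R)` for every `k` distinct
points is the unconditional periodisation bound `card_mul_eStar_le`). -/
theorem isMuGSC_empty : IsMuGSC lennardJones eStar (∅ : Set E3) :=
  isMuGSC_empty_iff.2 fun k R hR => by rw [mul_comm]; exact card_mul_eStar_le hR

/-- **No singleton is an `e*`-`μ`GSC**: evaporating the lone atom gains `−e* > 0`. -/
theorem not_isMuGSC_singleton (x : E3) : ¬ IsMuGSC lennardJones eStar ({x} : Set E3) := by
  intro h
  have key := tsum_sdiff_singleton_le h (Set.mem_singleton x)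
  haveI : IsEmpty ↥(({x} : Set E3) \ {x}) := Set.isEmpty_coe_sort.2 Set.sdiff_self
  rw [tsum_empty] at key
  linarith [eStar_neg]

/-- `V_LJ(t) ≥ −t⁻⁶/6` for every real `t` (the repulsive part is non-negative). -/
theorem neg_inv_pow_six_le_lennardJones (t : ℝ) : -(1 / 6) * t⁻¹ ^ 6 ≤ lennardJones t := by
  unfold lennardJones
  nlinarith [pow_nonneg (sq_nonneg t⁻¹) 6, show (t⁻¹) ^ 12 = (t⁻¹ ^ 2) ^ 6 by ring]

/-- **Local density at every atom.** In a uniformly discrete `e*`-`μ`GSC,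
`6·(−e*) ≤ ∑_{y ∈ S ∖ {x}} |x − y|⁻⁶` at every atom `x` (evaporation and `V_LJ ≥ −t⁻⁶/6`; the
sum converges by the shell bound). -/
theorem six_mul_neg_eStar_le_tsum (hS : UniformlyDiscrete S) (h : IsMuGSC lennardJones eStar S)
    {x : E3} (hx : x ∈ S) : 6 * -eStar ≤ ∑' y : ↥(S \ {x}), (dist x y)⁻¹ ^ 6 := by
  obtain ⟨δ, hδ, hsep⟩ := id hS
  have hsum6 : Summable fun y : ↥(S \ {x}) => (dist x (y : E3))⁻¹ ^ 6 :=
    (summable_inv_pow_six hδ le_rfl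
      (fun z hz => hsep x hx z hz.1 fun hxz => hz.2 (Set.mem_singleton_iff.2 hxz.symm))
      (fun z hz w hw hzw => hsep z hz.1 w hw.1 hzw)).1
  have hsumV : Summable fun y : ↥(S \ {x}) => lennardJones (dist x (y : E3)) :=
    (hS.mono Set.sdiff_subset).summable_lennardJones x
  have h1 : ∑' y : ↥(S \ {x}), -(1 / 6) * (dist x (y : E3))⁻¹ ^ 6 ≤
      ∑' y : ↥(S \ {x}), lennardJones (dist x (y : E3)) :=
    (hsum6.mul_left (-(1 / 6))).tsum_le_tsum
      (fun y : ↥(S \ {x}) => neg_inv_pow_six_le_lennardJones (dist x (y : E3))) hsumV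
  rw [tsum_mul_left] at h1
  have h2 := tsum_sdiff_singleton_le h hx
  linarith

/-- Hence `3 ≤ ∑_{y ∈ S ∖ {x}} |x − y|⁻⁶` at every atom (`e* ≤ −1/2`). -/
theorem three_le_tsum_inv_pow_six (hS : UniformlyDiscrete S) (h : IsMuGSC lennardJones eStar S)
    {x : E3} (hx : x ∈ S) : 3 ≤ ∑' y : ↥(S \ {x}), (dist x y)⁻¹ ^ 6 := by
  have := six_mul_neg_eStar_le_tsum hS h hx
  have hE : eStar ≤ -1 / 2 := LayeredLawsSelectHcp.Negative.Threshold.eStar_le_neg_half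
  linarith

/-- Numerical core of the hard-core lemma: `41 p > 40 u`, `u > 3` force
`p¹²/12 − (250/6) u⁶ > −1/2`. -/
private theorem hardCore_numerics {p u : ℝ} (hu : 3 < u) (h40 : 40 * u < 41 * p) :
    -1 / 2 < 1 / 12 * p ^ 12 - 250 / 6 * u ^ 6 := by
  have hu0 : 0 < u := by linarith
  have hX : (40 * u) ^ 6 < (41 * p) ^ 6 := pow_lt_pow_left₀ h40 (by positivity) (by norm_num)
  have hY : (3 : ℝ) ^ 6 < u ^ 6 := pow_lt_pow_left₀ hu (by norm_num) (by norm_num)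
  have hX2 := mul_self_lt_mul_self (by positivity) hX
  have hY2 := mul_lt_mul_of_pos_right hY (by positivity : (0 : ℝ) < u ^ 6)
  nlinarith [hX2, hY2, hY, hX, pow_pos hu0 6]

/-- **Uniform hard core.** Every uniformly discrete `e*`-`μ`GSC of Lennard-Jones in `ℝ³` is
`1/3`-separated (so every packing / shell constant downstream is universal).  Proof: let
`r₀ = infsep S > 0`; if `r₀ < 1/3`, pick atoms `a ≠ b` with `|a − b| < (41/40) r₀`; evaporation at
`a` reads `e* ≥ ∑_{z ≠ a} V(|a − z|) ≥ |a − b|⁻¹²/12 − (1/6)·250 r₀⁻⁶` (shell sum), which exceeds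
`−1/2 ≥ e*` — contradiction.  (Same mechanism as `LennardJonesMinimalDistance_holds` for finite
ground states.) -/
theorem le_dist (hS : UniformlyDiscrete S) (h : IsMuGSC lennardJones eStar S) :
    ∀ x ∈ S, ∀ y ∈ S, x ≠ y → 1 / 3 ≤ dist x y := by
  obtain ⟨δ, hδ, hsep⟩ := id hS
  intro x hx y hy hxy
  have hN : S.Nontrivial := ⟨x, hx, y, hy, hxy⟩
  have hr₀ : 0 < S.infsep := hδ.trans_le (hN.le_infsep hsep)
  have hall : ∀ a ∈ S, ∀ b ∈ S, a ≠ b → S.infsep ≤ dist a b := fun a ha b hb hab =>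
    Set.infsep_le_dist_of_mem ha hb hab
  by_contra hlt
  rw [not_le] at hlt
  have hr3 : S.infsep < 1 / 3 := (hall x hx y hy hxy).trans_lt hlt
  obtain ⟨a, ha, b, hb, hab, hd⟩ :=
    hN.infsep_lt_iff.1 (show S.infsep < 41 / 40 * S.infsep by linarith)
  set r₀ := S.infsep with hr₀_def
  have hba : b ∈ S \ {a} := ⟨hb, fun hba => hab (Set.mem_singleton_iff.1 hba).symm⟩
  obtain ⟨hsum6, htsum6⟩ := summable_inv_pow_six (X := S \ {a}) (p := a) hr₀ le_rfl
    (fun z hz => hall a ha z hz.1 fun haz => hz.2 (Set.mem_singleton_iff.2 haz.symm))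
    (fun z hz w hw hzw => hall z hz.1 w hw.1 hzw)
  have hsum12 : Summable fun z : ↥(S \ {a}) => (dist a (z : E3))⁻¹ ^ 12 := by
    refine Summable.of_nonneg_of_le (fun z => by positivity) (fun z => ?_) (hsum6.mul_left (r₀⁻¹ ^ 6))
    have hz : r₀ ≤ dist a (z : E3) :=
      hall a ha z z.2.1 fun haz => z.2.2 (Set.mem_singleton_iff.2 haz.symm)
    have h1 : (dist a (z : E3))⁻¹ ^ 6 ≤ r₀⁻¹ ^ 6 :=
      pow_le_pow_left₀ (inv_nonneg.2 dist_nonneg) (inv_anti₀ hr₀ hz) 6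
    calc (dist a (z : E3))⁻¹ ^ 12 = (dist a (z : E3))⁻¹ ^ 6 * (dist a (z : E3))⁻¹ ^ 6 := by ring
      _ ≤ r₀⁻¹ ^ 6 * (dist a (z : E3))⁻¹ ^ 6 := mul_le_mul_of_nonneg_right h1 (by positivity)
  have hev := tsum_sdiff_singleton_le h ha
  have hsplit : ∑' z : ↥(S \ {a}), lennardJones (dist a (z : E3)) =
      ∑' z : ↥(S \ {a}), (1 / 12 * (dist a (z : E3))⁻¹ ^ 12 - 1 / 6 * (dist a (z : E3))⁻¹ ^ 6) := rfl
  rw [hsplit, (hsum12.mul_left (1 / 12)).tsum_sub (hsum6.mul_left (1 / 6)), tsum_mul_left,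
    tsum_mul_left] at hev
  have h12 : (dist a b)⁻¹ ^ 12 ≤ ∑' z : ↥(S \ {a}), (dist a (z : E3))⁻¹ ^ 12 :=
    hsum12.le_tsum ⟨b, hba⟩ fun _ _ => by positivity
  have hdpos : 0 < dist a b := dist_pos.2 hab
  have hu3 : (3 : ℝ) < r₀⁻¹ := (lt_inv_comm₀ (by norm_num) hr₀).2 (hr3.trans_eq (one_div 3))
  have h40 : 40 * r₀⁻¹ < 41 * (dist a b)⁻¹ := by
    rw [← div_eq_mul_inv, ← div_eq_mul_inv, div_lt_div_iff₀ hr₀ hdpos]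
    linarith
  have hnum := hardCore_numerics hu3 h40
  have : r₀⁻¹ ^ 3 * r₀⁻¹ ^ 3 = r₀⁻¹ ^ 6 := by ring
  rw [this] at htsum6
  have hE : eStar ≤ -1 / 2 := LayeredLawsSelectHcp.Negative.Threshold.eStar_le_neg_half
  linarith

/-- **Packing about an atom (upper volume bound).** In a uniformly discrete `e*`-`μ`GSC,
`#(S ∩ B̄_R(x)) ≤ (6R + 1)³` for every `x` and `R ≥ 0` (hard core `1/3`). -/
theorem ncard_le (hS : UniformlyDiscrete S) (h : IsMuGSC lennardJones eStar S) (x : E3) {R : ℝ}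
    (hR : 0 ≤ R) : ({y ∈ S | dist y x ≤ R}.ncard : ℝ) ≤ (6 * R + 1) ^ 3 := by
  have hfin : {y ∈ S | dist y x ≤ R}.Finite := hS.finite_inter_closedBall x R
  rw [Set.ncard_eq_toFinset_card _ hfin]
  have := card_le_of_separated_of_dist_le hfin.toFinset x (by norm_num : (0 : ℝ) < 1 / 3) hR
    (fun c hc => ((Set.Finite.mem_toFinset hfin).1 hc).2)
    (fun c hc c' hc' hcc' => le_dist hS h c ((Set.Finite.mem_toFinset hfin).1 hc).1 c'
      ((Set.Finite.mem_toFinset hfin).1 hc').1 hcc')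
  rw [finrank_euclideanSpace_fin] at this
  convert this using 2
  ring

/-- **No isolated atom.** In a uniformly discrete `e*`-`μ`GSC every atom has another atom within
distance `14`: otherwise the shell bound (hard core `1/3`, distance `≥ 14`) caps
`∑_{y ≠ x} |x − y|⁻⁶` by `250·27/14³ < 3`, against the local density bound. -/
theorem exists_dist_lt (hS : UniformlyDiscrete S) (h : IsMuGSC lennardJones eStar S) {x : E3}
    (hx : x ∈ S) : ∃ y ∈ S, y ≠ x ∧ dist x y < 14 := by
  by_contra hex
  have hfar : ∀ y ∈ S, y ≠ x → 14 ≤ dist x y := fun y hy hyx =>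
    not_lt.1 fun hlt => hex ⟨y, hy, hyx, hlt⟩
  have h3 := three_le_tsum_inv_pow_six hS h hx
  obtain ⟨-, hle⟩ := summable_inv_pow_six (X := S \ {x}) (p := x) (by norm_num : (0 : ℝ) < 1 / 3)
    (by norm_num : (1 : ℝ) / 3 ≤ 14)
    (fun z hz => hfar z hz.1 fun hzx => hz.2 (Set.mem_singleton_iff.2 hzx))
    (fun z hz w hw hzw => le_dist hS h z hz.1 w hw.1 hzw)
  have : (250 : ℝ) * ((1 / 3)⁻¹ ^ 3 * (14 : ℝ)⁻¹ ^ 3) < 3 := by norm_num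
  linarith

/-- **Registered marker `stub_dlrBadZeroDensity_part01`** (groundwork for the open stub S3′ of line
`equilibrium-in-law-surgery`, crux `MinimiserShells`): every uniformly discrete Sütő `μ`GSC of Lennard-Jones at
`μ = e*` is UNIFORMLY `1/3`-separated (`le_dist`) — the first lemma of any DLR-class argument with uniform constants. -/
theorem stub_dlrBadZeroDensity_part01 :
    ∀ S : Set (EuclideanSpace ℝ (Fin 3)), UniformlyDiscrete S → IsMuGSC lennardJones eStar S →
      ∀ x ∈ S, ∀ y ∈ S, x ≠ y → 1 / 3 ≤ dist x y :=
  fun _ hS h => le_dist hS h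

end LennardJones

end Summit.AtomisticToContinuum.Crystallization.Theorems.PalmUnimodularRigidityMinimiserShells.VolumeGrowth.Basics

end
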